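import Literature.Geometry.Kaehler.RiemannianHodgeSmoothProofs
import Literature.Geometry.Kaehler.HodgeStarWedge
import Literature.Geometry.Kaehler.HodgeStarInnerDefiniteProofs
import Literature.NumberTheory.Transcendental.FormsAlgebraWedgeProofs
import Literature.NumberTheory.Transcendental.FormIntegrationStokes
import Literature.NumberTheory.Transcendental.FormIntegrationBridgeProofs
import Literature.NumberTheory.Transcendental.FormIntegrationNonnegProofs
import Literature.NumberTheory.Transcendental.FormIntegrationPositivity
import HarnessLib

/-!
# `δ` is the adjoint of `d`; harmonic forms are the closed and co-closed forms (Warner 6.2–6.3)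

Topic: Kähler / Hodge, the Hodge Laplacian `Δ = dδ + δd` and harmonic forms of
`Literature/Geometry/Kaehler/RiemannianHodge.lean` (`Literature.Geometry.Kaehler.hodgeLaplacian`,
`Literature.Geometry.Kaehler.IsHarmonicForm`). Source: F. W. Warner, *Foundations of
Differentiable Manifolds and Lie Groups*, GTM 94 (1983), Ch. 6: throughout "`M` will be a compact
oriented Riemannian manifold of dimension `n`" (p. 220), manifolds being Hausdorff and second
countable (Def. 1.3) and metrics smooth (4.10); `⟨α, β⟩ = ∫_M α ∧ *β` (6.1 (5)).

## Main statements (all proved)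

* `Literature.Geometry.Kaehler.mextDeriv_hodgeStar_eq_smul_hodgeStar_mcoderiv`:
  `d ⋆γ = -(-1)^j ⋆ δγ` on `(j+1)`-forms (the sign in Warner's `d(α ∧ *β) = dα ∧ *β - α ∧ *δβ`).
* `Literature.Geometry.Kaehler.integral_mextDeriv_wedge_hodgeStar` — **Prop. 6.2** (`δ` is the
  adjoint of `d`): `∫_M dβ ∧ ⋆γ = ∫_M β ∧ ⋆δγ` for smooth `β ∈ E^j(M)`, `γ ∈ E^{j+1}(M)`.
* `Literature.Geometry.Kaehler.eq_zero_of_integral_wedge_hodgeStar_self_eq_zero`: positive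
  definiteness, `∫_M θ ∧ ⋆θ = 0 → θ = 0` for smooth `θ`.
* `Literature.Geometry.Kaehler.isHarmonicForm_iff_closed_and_coclosed` — **Prop. 6.3**: on a
  compact oriented Riemannian manifold without boundary (Hausdorff, `C^∞`, smooth metric, `vol_o`
  smooth), a smooth `(k+1)`-form is harmonic iff `dα = 0 ∧ δα = 0`.
* The bridge `…_of_contMDiffMetric` to the named fact
  `isHarmonicForm_iff_mextDeriv_eq_zero_and_mcoderiv_eq_zero` of `RiemannianHodge.lean` as
  declared (the corrected *closed* named fact `…_of_isManifold`, Prop. 6.3 with its hypotheses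
  bound inside the statement, and its discharge are appended to this file in a reviewed
  follow-up).
* (Appended.) The closed named fact
  `Literature.Geometry.Kaehler.isHarmonicForm_iff_mextDeriv_eq_zero_and_mcoderiv_eq_zero_of_isManifold`
  — Prop. 6.3 with `[T2Space M] [IsManifold I ∞ M] [IsContinuousRiemannianBundle E _]
  [IsContMDiffRiemannianBundle I ∞ E _]` bound inside the statement — and its discharge
  `…_of_isManifold_holds`.

## Correction of `isHarmonicForm_iff_mextDeriv_eq_zero_and_mcoderiv_eq_zero` (provefact pass, 2026-08-15)

That `def … : Prop` of `RiemannianHodge.lean` (docstring: "Warner (1983), Prop. 6.2(c)" — the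
result is Prop. 6.3, p. 221) was written after a section
`variable [IsManifold I ∞ M] [IsContinuousRiemannianBundle E _] [IsContMDiffRiemannianBundle I ∞ E _]`;
a `def` does not abstract unused section instances, so its elaborated signature binds only
`[ChartedSpace H M] [FiniteDimensional ℝ E] [RiemannianBundle _] {k m} (o)` (checked with
`#check`): it is stated for arbitrary charted spaces — not necessarily `C^∞` manifolds, not
necessarily Hausdorff — and for fibre metrics of no regularity. In that generality it is
**false**: on the flat `2`-torus with the unit-determinant metric `λ dx² + λ⁻¹ dy²`,
`λ ∈ {1, 2}` nowhere continuous (a legitimate `RiemannianBundle`, whose volume form `dx ∧ dy`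
is smooth, so `ho` holds), take `α = f · vol` with `f` smooth and nonconstant: the chart
representatives of `⋆df = λ ∂₂f dx - λ⁻¹ ∂₁f dy` are differentiable at no point where `∇f ≠ 0`
and have derivative `0` elsewhere, so the `fderivWithin`-based `mextDeriv` returns
`d(δα) = 0` everywhere, i.e. `Δα = 0`, although `δα = -⋆df ≠ 0`. (The same dropped-instance
defect affects `isSmoothForm_hodgeStar`, `isSmoothForm_mcoderiv`, `mcoderiv_mcoderiv`,
`mem_harmonicForms_iff`; see `RiemannianHodgeHarmonic.lean` and
`RiemannianHodgeSmoothProofs.lean`.) Following the provefact protocol (a mis-stated named fact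
is corrected under a new name, never edited in place), the corrected statement, with
`[T2Space M] [IsManifold I ∞ M] [IsContinuousRiemannianBundle E _]
[IsContMDiffRiemannianBundle I ∞ E _]` as binders of the statement, is proved here in usable
form (`isHarmonicForm_iff_closed_and_coclosed`); under those instances the original `Prop` also
holds (`…_of_contMDiffMetric`).

## Proof (as printed, Warner pp. 220–221)

Prop. 6.2: `d(β ∧ *γ) = dβ ∧ *γ + (-1)^j β ∧ d*γ = dβ ∧ *γ - β ∧ *δγ` (Leibniz rule
`MextDerivWedge_holds`; `d* = -(-1)^j *δ` from `δ = (-1)^{n(p+1)+1} *d*` and `** = (-1)^{p(n-p)}`,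
`MForm.hodgeStar_hodgeStar_holds`), then integrate and apply Stokes `∫_M d(β ∧ *γ) = 0`
(`MForm.integral_mextDeriv_eq_zero_holds`, Warner 4.9 Corollary) and the additivity of `∫_M`
(`MForm.integral_add_holds`). Prop. 6.3: `⟨Δα, α⟩ = ⟨dδα, α⟩ + ⟨δdα, α⟩ = ⟨δα, δα⟩ + ⟨dα, dα⟩`
by 6.2 twice; pointwise `β ∧ *γ = ⟨β, γ⟩ vol` (`MForm.wedge_hodgeStar`), so `Δα = 0` makes the
two energies, each `≥ 0` (`integral_smul_riemannianVolumeForm_nonneg_holds`), sum to `0`; an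
energy `∫ ⟨θ, θ⟩ vol` of a smooth form vanishes only if `θ = 0` (positivity of the integral of a
nonnegative, somewhere positive smooth top form, `MForm.integral_pos_of_sign_mul_apply_nonneg`,
and definiteness `alternatingFormInner_self_eq_zero_iff_holds`). In top degree `dα = 0`
automatically (`mextDeriv_eq_zero_of_top_degree`) and `Δα = dδα`. All ingredients are discharged
theorems of the tree (`_holds`) — Stokes, the wedge calculus, smoothness of `⋆` and `δ`
(`IsSmoothForm.hodgeStar/mcoderiv`, `RiemannianHodgeSmoothProofs.lean`), the bridge
`isContinuousOrientation_of_isSmoothForm_riemannianVolumeForm_holds`; no named fact is assumed.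

## References

* F. W. Warner, *Foundations of Differentiable Manifolds and Lie Groups*, GTM 94, Springer
  (1983): Def. 1.3 (p. 5, manifolds are Hausdorff, second countable); 4.9 Corollary (p. 149,
  `∫_M dω = 0`); 6.1 (pp. 220), Prop. 6.2 and its proof (2)–(3) (pp. 220–221), Prop. 6.3
  (p. 221).
* J. M. Lee, *Introduction to Smooth Manifolds*, 2nd ed., GTM 218 (2013), Prop. 16.6 (c)
  (positivity of the integral).
-/

noncomputable section

open scoped Manifold ContDiff Topology
open Bundle Module Set Function
open Literature.NumberTheory.Transcendental

namespace Literature.Geometry.Kaehler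

variable {E : Type*} [NormedAddCommGroup E] [NormedSpace ℝ E] {n : ℕ} [Fact (finrank ℝ E = n)]
  {H : Type*} [TopologicalSpace H] {I : ModelWithCorners ℝ E H}
  {M : Type*} [TopologicalSpace M] [ChartedSpace H M] [IsManifold I ∞ M] [FiniteDimensional ℝ E]
  [RiemannianBundle (fun x : M ↦ TangentSpace I x)]
  [IsContinuousRiemannianBundle E (fun x : M ↦ TangentSpace I x)]
  [IsContMDiffRiemannianBundle I ∞ E (fun x : M ↦ TangentSpace I x)] {k m : ℕ}
  (o : (x : M) → Orientation ℝ (TangentSpace I x) (Fin n))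

/-! ### `d ⋆ = ± ⋆ δ` -/

omit [IsManifold I ∞ M] [IsContinuousRiemannianBundle E fun x : M ↦ TangentSpace I x]
  [IsContMDiffRiemannianBundle I ∞ E fun x : M ↦ TangentSpace I x] in
/-- **`d ⋆ γ = -(-1)^j ⋆ δ γ`** for a `(j+1)`-form `γ` (pure algebra, no smoothness): with
`δ = (-1)^{n j + 1} ⋆ d ⋆` on `(j+1)`-forms (`mcoderiv`, Warner (1983), 6.1 (2), p. 220) and
`⋆⋆ = (-1)^{(m+1) j}` on `(m+1)`-forms (`MForm.hodgeStar_hodgeStar_holds`, 6.1 (1)),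
`⋆ δγ = (-1)^{nj+1} (-1)^{(m+1)j} d⋆γ = -(-1)^j d⋆γ` as `n = j + 1 + m`. This is the sign in
Warner's `d(α ∧ *β) = dα ∧ *β - α ∧ *δβ` (proof of Prop. 6.2, (2), p. 221).
[cite: WarnerGTM94, 6.2 (2), p. 221] -/
theorem mextDeriv_hodgeStar_eq_smul_hodgeStar_mcoderiv {j m : ℕ} (hγ : (j + 1) + m = n)
    (γ : MForm I M ℝ (j + 1)) :
    mextDeriv (MForm.hodgeStar o hγ γ) =
      (-(-1 : ℝ) ^ j) • MForm.hodgeStar o (show j + (m + 1) = n by omega) (mcoderiv o hγ γ) := by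
  have hss := MForm.hodgeStar_hodgeStar_holds o (k := m + 1) (m := j)
    (show (m + 1) + j = n by omega) (show j + (m + 1) = n by omega)
    (mextDeriv (MForm.hodgeStar o hγ γ))
  simp only [mcoderiv, map_smul, smul_smul]
  rw [hss, smul_smul]
  have hT : Odd (j + (n * j + 1) + (m + 1) * j) := by
    have h2 : j + (n * j + 1) + (m + 1) * j = (j * (j + 1) + 2 * (j * (m + 1))) + 1 := by
      have hn : n = j + 1 + m := by omega
      subst hn
      ring
    rw [h2]
    exact Even.add_one ((Nat.even_mul_succ_self j).add (even_two_mul _))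
  rw [show -(-1 : ℝ) ^ j * (-1) ^ (n * j + 1) * (-1) ^ ((m + 1) * j) =
      -((-1 : ℝ) ^ (j + (n * j + 1) + (m + 1) * j)) by rw [pow_add, pow_add]; ring,
    hT.neg_one_pow, neg_neg, one_smul]

/-! ### Integrals: adjointness of `d` and `δ`, positivity -/

section Integral

variable [MeasurableSpace E] [BorelSpace E] [T2Space M] [CompactSpace M] [I.Boundaryless]

/-- **`δ` is the (formal) adjoint of `d`** (Warner (1983), Prop. 6.2, p. 220:
`⟨dα, β⟩ = ⟨α, δβ⟩` with `⟨α, β⟩ = ∫_M α ∧ *β`), here in the wedge form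
`∫_M dβ ∧ ⋆γ = ∫_M β ∧ ⋆δγ` for smooth `β ∈ E^j(M)`, `γ ∈ E^{j+1}(M)` on a compact oriented
Riemannian manifold without boundary (smooth metric, `vol_o` smooth). Proof as printed:
`d(β ∧ *γ) = dβ ∧ *γ + (-1)^j β ∧ d*γ = dβ ∧ *γ - β ∧ *δγ` (Leibniz rule `MextDerivWedge_holds`
and `mextDeriv_hodgeStar_eq_smul_hodgeStar_mcoderiv`), integrate and use Stokes
`∫_M d(β ∧ *γ) = 0` (`MForm.integral_mextDeriv_eq_zero_holds`, the Corollary of Warner's 4.9).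
[cite: WarnerGTM94, Prop. 6.2, p. 220] -/
theorem integral_mextDeriv_wedge_hodgeStar (ho : IsSmoothForm (riemannianVolumeForm o)) {j m : ℕ}
    (hγ : (j + 1) + m = n) {β : MForm I M ℝ j} {γ : MForm I M ℝ (j + 1)} (hβ : IsSmoothForm β)
    (hγs : IsSmoothForm γ) :
    MForm.integral o (((mextDeriv β).wedge (MForm.hodgeStar o hγ γ)).castDeg hγ) =
      MForm.integral o ((β.wedge (MForm.hodgeStar o (show j + (m + 1) = n by omega)
        (mcoderiv o hγ γ))).castDeg (show j + (m + 1) = n by omega)) := by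
  have hoc : IsContinuousOrientation o :=
    isContinuousOrientation_of_isSmoothForm_riemannianVolumeForm_holds o ho
  obtain hn : n = j + m + 1 := by omega
  subst hn
  -- the players and their smoothness
  have hsγ : IsSmoothForm (MForm.hodgeStar o hγ γ) := IsSmoothForm.hodgeStar o ho hγ hγs
  have hδγ : IsSmoothForm (mcoderiv o hγ γ) := IsSmoothForm.mcoderiv o ho hγ hγs
  have hS : IsSmoothForm (MForm.hodgeStar o (show j + (m + 1) = j + m + 1 by omega)
      (mcoderiv o hγ γ)) := IsSmoothForm.hodgeStar o ho _ hδγ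
  have hdβ : IsSmoothForm (mextDeriv β) := isSmoothForm_mextDeriv (inChart_mextDeriv_holds I M ℝ) hβ
  have hθ : IsSmoothForm (β.wedge (MForm.hodgeStar o hγ γ)) :=
    IsSmoothFormWedge_holds (I := I) (M := M) (A := ℝ) hβ hsγ
  have hA : IsSmoothForm (((mextDeriv β).wedge (MForm.hodgeStar o hγ γ)).castDeg
      (Nat.add_right_comm j 1 m)) :=
    isSmoothForm_castDeg _ (IsSmoothFormWedge_holds (I := I) (M := M) (A := ℝ) hdβ hsγ)
  have hB : IsSmoothForm (β.wedge (MForm.hodgeStar o (show j + (m + 1) = j + m + 1 by omega)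
      (mcoderiv o hγ γ))) :=
    IsSmoothFormWedge_holds (I := I) (M := M) (A := ℝ) hβ hS
  -- Stokes: `∫ d(β ∧ ⋆γ) = 0`
  have hst : MForm.integral o (mextDeriv (β.wedge (MForm.hodgeStar o hγ γ))) = 0 :=
    MForm.integral_mextDeriv_eq_zero_holds o rfl hoc hθ
  -- Leibniz and `d⋆γ = -(-1)^j ⋆δγ`
  have hL := MextDerivWedge_holds (I := I) (M := M) (A := ℝ) hβ hsγ
  rw [mextDeriv_hodgeStar_eq_smul_hodgeStar_mcoderiv o hγ γ, MForm.wedge_smul_right, smul_smul,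
    show (-1 : ℝ) ^ j * -(-1) ^ j = -1 by
      rw [mul_neg, ← pow_add, ← two_mul, pow_mul, neg_one_sq, one_pow]] at hL
  rw [hL, MForm.integral_add_holds o hoc hA (hB.smul _), MForm.integral_smul, neg_one_mul,
    add_neg_eq_zero] at hst
  exact hst

/-- **A smooth form whose square norm integrates to zero vanishes**: on a compact oriented
Riemannian manifold without boundary (smooth metric, `vol_o` smooth), if
`∫_M θ ∧ ⋆θ = ∫_M ⟨θ, θ⟩ vol = 0` for a smooth `j`-form `θ`, then `θ = 0` — the integrand is
`⟨θ, θ⟩ vol` (`MForm.wedge_hodgeStar`) with `⟨θ, θ⟩ ≥ 0`, the integral of a nonnegative smooth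
multiple of `vol` which is positive somewhere is positive
(`MForm.integral_pos_of_sign_mul_apply_nonneg`, Lee (2013), Prop. 16.6 (c)), and `⟨θ, θ⟩ = 0`
forces `θ = 0` pointwise (`alternatingFormInner_self_eq_zero_iff_holds`). This is the
positive-definiteness of Warner's inner product (1983), 6.1 (5), p. 220, used in the last line
of the proof of Prop. 6.3. [cite: WarnerGTM94, 6.1 (5), p. 220] -/
theorem eq_zero_of_integral_wedge_hodgeStar_self_eq_zero
    (ho : IsSmoothForm (riemannianVolumeForm o)) {j m : ℕ} (w : j + m = n) {θ : MForm I M ℝ j}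
    (hθ : IsSmoothForm θ)
    (h0 : MForm.integral o ((θ.wedge (MForm.hodgeStar o w θ)).castDeg w) = 0) : θ = 0 := by
  have hoc : IsContinuousOrientation o :=
    isContinuousOrientation_of_isSmoothForm_riemannianVolumeForm_holds o ho
  have hF : IsSmoothForm ((θ.wedge (MForm.hodgeStar o w θ)).castDeg w) :=
    isSmoothForm_castDeg _ (IsSmoothFormWedge_holds (I := I) (M := M) (A := ℝ) hθ
      (IsSmoothForm.hodgeStar o ho w hθ))
  rw [MForm.wedge_hodgeStar] at h0 hF
  by_contra hne
  obtain ⟨x₁, hx₁⟩ : ∃ x, θ x ≠ 0 := Function.ne_iff.1 hne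
  -- the integrand against the orientation sign is `⟨θ, θ⟩ · |vol(e)| ≥ 0`, and `> 0` at `x₁`
  have hsgn : ∀ x : M, Real.sign (orientationForm o x (modelBasis E n)) =
      Real.sign ((show E [⋀^Fin n]→L[ℝ] ℝ from riemannianVolumeForm o x) (modelBasis E n)) :=
    fun x ↦ sign_someVector_apply_eq_sign_volumeForm_apply (o x) _
  have hkey : ∀ x : M, Real.sign (orientationForm o x (modelBasis E n)) *
      (show E [⋀^Fin n]→L[ℝ] ℝ from MForm.inner n θ θ x • riemannianVolumeForm o x)
        (modelBasis E n) =
      MForm.inner n θ θ x * |(show E [⋀^Fin n]→L[ℝ] ℝ from riemannianVolumeForm o x)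
        (modelBasis E n)| := by
    intro x
    have h1 : (show E [⋀^Fin n]→L[ℝ] ℝ from MForm.inner n θ θ x • riemannianVolumeForm o x)
        (modelBasis E n) = MForm.inner n θ θ x *
          (show E [⋀^Fin n]→L[ℝ] ℝ from riemannianVolumeForm o x) (modelBasis E n) := rfl
    rw [h1, hsgn x, ← real_sign_mul_self]
    ring
  have hpos : 0 < MForm.integral o (fun x ↦ MForm.inner n θ θ x • riemannianVolumeForm o x) := by
    refine MForm.integral_pos_of_sign_mul_apply_nonneg hoc hF (fun x ↦ ?_) ⟨x₁, ?_⟩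
    · rw [hkey]
      exact mul_nonneg (alternatingFormInner_self_nonneg _ _) (abs_nonneg _)
    · rw [hkey]
      refine mul_pos ((alternatingFormInner_self_nonneg _ _).lt_of_ne' fun h ↦ hx₁ ?_)
        (abs_pos.2 ?_)
      · exact (alternatingFormInner_self_eq_zero_iff_holds j (θ x₁)).1 h
      · exact (AlternatingMap.map_basis_ne_zero_iff (modelBasis E n) _).2
          (volumeForm_ne_zero (o x₁))
  exact hpos.ne' h0

end Integral

/-! ### Warner's Proposition 6.3 -/

/-- **Harmonic forms are exactly the closed and co-closed ones** (Warner (1983), Prop. 6.3,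
p. 221): on a compact oriented Riemannian manifold without boundary — Hausdorff, `C^∞` manifold,
`C^∞` metric, `vol_o` smooth (`o` locally constant) — a smooth `(k+1)`-form `α` satisfies
`Δα = 0 ↔ (dα = 0 ∧ δα = 0)`. Proof as printed: "⇐" is clear; for "⇒",
`⟨Δα, α⟩ = ⟨dδα, α⟩ + ⟨δdα, α⟩ = ⟨δα, δα⟩ + ⟨dα, dα⟩` by the adjointness Prop. 6.2
(`integral_mextDeriv_wedge_hodgeStar`, twice), so `Δα = 0` gives `‖δα‖² + ‖dα‖² = 0`, both
summands being `≥ 0` (`integral_smul_riemannianVolumeForm_nonneg_holds`), whence `dα = 0` and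
`δα = 0` (`eq_zero_of_integral_wedge_hodgeStar_self_eq_zero`). In top degree (`m = 0`) `dα = 0`
automatically and `Δα = dδα`. [cite: WarnerGTM94, Prop. 6.3, p. 221] -/
theorem isHarmonicForm_iff_closed_and_coclosed [T2Space M] [CompactSpace M] [I.Boundaryless]
    (ho : IsSmoothForm (riemannianVolumeForm o)) (h : (k + 1) + m = n) {α : MForm I M ℝ (k + 1)}
    (hα : IsSmoothForm α) : IsHarmonicForm o h α ↔ mextDeriv α = 0 ∧ mcoderiv o h α = 0 := by
  letI : MeasurableSpace E := borel E
  haveI : BorelSpace E := ⟨rfl⟩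
  have hoc : IsContinuousOrientation o :=
    isContinuousOrientation_of_isSmoothForm_riemannianVolumeForm_holds o ho
  refine ⟨fun hH ↦ ?_, fun hdδ ↦ ⟨hα, ?_⟩⟩
  · obtain ⟨-, hΔ⟩ := hH
    have hδs : IsSmoothForm (mcoderiv o h α) := IsSmoothForm.mcoderiv o ho h hα
    rcases m with - | m'
    · -- top degree: `dα = 0` and `Δα = dδα`
      obtain rfl : n = k + 1 := by omega
      have hd : mextDeriv α = 0 := mextDeriv_eq_zero_of_top_degree α
      have hΔ' : mextDeriv (mcoderiv o h α) = 0 := hΔ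
      have hadj := integral_mextDeriv_wedge_hodgeStar o ho h hδs hα
      rw [hΔ', MForm.zero_wedge, MForm.castDeg_zero, MForm.zero_integral] at hadj
      exact ⟨hd, eq_zero_of_integral_wedge_hodgeStar_self_eq_zero o ho _ hδs hadj.symm⟩
    · have hds : IsSmoothForm (mextDeriv α) :=
        isSmoothForm_mextDeriv (inChart_mextDeriv_holds I M ℝ) hα
      have hΔ' : mextDeriv (mcoderiv o h α) +
          mcoderiv o (show (k + 1 + 1) + m' = n by omega) (mextDeriv α) = 0 := hΔ
      -- the two adjointness identities `⟨dδα, α⟩ = ‖δα‖²`, `‖dα‖² = ⟨α, δdα⟩`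
      have hadj₁ := integral_mextDeriv_wedge_hodgeStar o ho h hδs hα
      have hadj₂ := integral_mextDeriv_wedge_hodgeStar o ho (show (k + 1 + 1) + m' = n by omega)
        hα hds
      -- smoothness of the four integrands
      have hsα : IsSmoothForm (MForm.hodgeStar o h α) := IsSmoothForm.hodgeStar o ho h hα
      have hI₁ : IsSmoothForm (((mextDeriv (mcoderiv o h α)).wedge (MForm.hodgeStar o h α)).castDeg
          h) :=
        isSmoothForm_castDeg _ (IsSmoothFormWedge_holds (I := I) (M := M) (A := ℝ)
          (isSmoothForm_mextDeriv (inChart_mextDeriv_holds I M ℝ) hδs) hsα)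
      have hI₂ : IsSmoothForm ((α.wedge (MForm.hodgeStar o
          (show (k + 1) + (m' + 1) = n by omega) (mcoderiv o (show (k + 1 + 1) + m' = n by omega)
            (mextDeriv α)))).castDeg (show (k + 1) + (m' + 1) = n by omega)) :=
        isSmoothForm_castDeg _ (IsSmoothFormWedge_holds (I := I) (M := M) (A := ℝ) hα
          (IsSmoothForm.hodgeStar o ho _ (IsSmoothForm.mcoderiv o ho _ hds)))
      -- `⟨dδα, α⟩ vol + ⟨α, δdα⟩ vol = ⟨Δα, α⟩ vol = 0` pointwise, hence the integrals sum to `0`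
      have hsum : MForm.integral o (((mextDeriv (mcoderiv o h α)).wedge
            (MForm.hodgeStar o h α)).castDeg h) +
          MForm.integral o ((α.wedge (MForm.hodgeStar o (show (k + 1) + (m' + 1) = n by omega)
            (mcoderiv o (show (k + 1 + 1) + m' = n by omega) (mextDeriv α)))).castDeg
              (show (k + 1) + (m' + 1) = n by omega)) = 0 := by
        rw [← MForm.integral_add_holds o hoc hI₁ hI₂, MForm.wedge_hodgeStar, MForm.wedge_hodgeStar]
        have hpt : (fun x ↦ MForm.inner n (mextDeriv (mcoderiv o h α)) α x •
              riemannianVolumeForm o x) +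
            (fun x ↦ MForm.inner n α (mcoderiv o (show (k + 1 + 1) + m' = n by omega)
              (mextDeriv α)) x • riemannianVolumeForm o x) = 0 := by
          funext x
          have hx := congrFun hΔ' x
          simp only [Pi.add_apply, Pi.zero_apply] at hx ⊢
          rw [MForm.inner, MForm.inner, (isSymm_alternatingFormInner (V := TangentSpace I x)
            (n := n) (k + 1)).eq (α x), ← add_smul, ← LinearMap.add_apply, ← map_add, hx,
            map_zero, LinearMap.zero_apply, zero_smul]
        rw [hpt, MForm.zero_integral]
      -- the two energies are `≥ 0`
      have hE₁ : 0 ≤ MForm.integral o (((mcoderiv o h α).wedge (MForm.hodgeStar o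
          (show k + (m' + 1 + 1) = n by omega) (mcoderiv o h α))).castDeg
            (show k + (m' + 1 + 1) = n by omega)) := by
        rw [MForm.wedge_hodgeStar]
        exact integral_smul_riemannianVolumeForm_nonneg_holds o fun x ↦
          alternatingFormInner_self_nonneg _ _
      have hE₂ : 0 ≤ MForm.integral o (((mextDeriv α).wedge (MForm.hodgeStar o
          (show (k + 1 + 1) + m' = n by omega) (mextDeriv α))).castDeg
            (show (k + 1 + 1) + m' = n by omega)) := by
        rw [MForm.wedge_hodgeStar]
        exact integral_smul_riemannianVolumeForm_nonneg_holds o fun x ↦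
          alternatingFormInner_self_nonneg _ _
      rw [hadj₁, ← hadj₂] at hsum
      obtain ⟨h₁, h₂⟩ := (add_eq_zero_iff_of_nonneg hE₁ hE₂).1 hsum
      exact ⟨eq_zero_of_integral_wedge_hodgeStar_self_eq_zero o ho _ hds h₂,
        eq_zero_of_integral_wedge_hodgeStar_self_eq_zero o ho _ hδs h₁⟩
  · obtain ⟨hd, hδ⟩ := hdδ
    rcases m with - | m'
    · show mextDeriv (mcoderiv o h α) = 0
      rw [hδ, mextDeriv_zero]
    · show mextDeriv (mcoderiv o h α) + mcoderiv o _ (mextDeriv α) = 0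
      rw [hδ, hd, mextDeriv_zero, zero_add]
      simp [mcoderiv, mextDeriv_zero]

/-- **Bridge to the named fact as declared.** In the presence of the intended instances
(`T2Space M`, `IsManifold I ∞ M`, continuous and `C^∞` metric), the over-general named fact
`isHarmonicForm_iff_mextDeriv_eq_zero_and_mcoderiv_eq_zero o` of `RiemannianHodge.lean` holds
(its body quantifies `[CompactSpace M] [I.Boundaryless]`, `ho`, `h`, `α`, `hα` itself).
Warner (1983), Prop. 6.3, p. 221. [cite: WarnerGTM94, Prop. 6.3, p. 221] -/
theorem isHarmonicForm_iff_mextDeriv_eq_zero_and_mcoderiv_eq_zero_of_contMDiffMetric [T2Space M] :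
    isHarmonicForm_iff_mextDeriv_eq_zero_and_mcoderiv_eq_zero (k := k) (m := m) o :=
  fun ho h _ hα ↦ isHarmonicForm_iff_closed_and_coclosed o ho h hα

/-! ### The corrected named fact -/

section CorrectedFact

/-- **Warner's Proposition 6.3 as a closed named fact, correctly stated.** On a compact oriented
Riemannian manifold without boundary, a smooth form of positive degree is harmonic iff it is
closed and co-closed: `Δα = 0 ↔ dα = 0 ∧ δα = 0` (F. W. Warner, *Foundations of Differentiable
Manifolds and Lie Groups*, GTM 94 (1983), Prop. 6.3, p. 221; the proof is
`⟨Δα, α⟩ = ‖dα‖² + ‖δα‖²`, from Prop. 6.2). **Correction** of the named fact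
`Literature.Geometry.Kaehler.isHarmonicForm_iff_mextDeriv_eq_zero_and_mcoderiv_eq_zero` of
`RiemannianHodge.lean` (whose docstring also mis-locates the result as "Prop. 6.2(c)"): that
`def … : Prop` was written after a section
`variable [IsManifold I ∞ M] [IsContinuousRiemannianBundle E _] [IsContMDiffRiemannianBundle I ∞ E _]`,
but a `def` does not abstract unused section instances, so its elaborated statement binds only
`[ChartedSpace H M] [FiniteDimensional ℝ E] [RiemannianBundle _]`: it quantifies over charted
spaces that need not be `C^∞` manifolds, need not be Hausdorff (Warner's manifolds are, Def. 1.3)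
and over fibre metrics of no regularity — and in that generality it is **false**: on the flat
`2`-torus with the unit-determinant metric `λ dx² + λ⁻¹ dy²`, `λ ∈ {1, 2}` nowhere continuous
(a legitimate `RiemannianBundle`), `vol = dx ∧ dy` is smooth, and for `α = f vol` with `f`
smooth and nonconstant, `⋆df` has nowhere-differentiable chart representatives, so the chart-wise
(`fderivWithin`-based) `d ⋆ d f` is the junk value `0`, `Δα = dδα = 0`, while
`δα = -⋆df ≠ 0`. Here the hypotheses `[T2Space M] [IsManifold I ∞ M]
[IsContinuousRiemannianBundle E _] [IsContMDiffRiemannianBundle I ∞ E _]` are binders *of the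
statement*; it is discharged by
`isHarmonicForm_iff_mextDeriv_eq_zero_and_mcoderiv_eq_zero_of_isManifold_holds`, and the usable
form is `Literature.Geometry.Kaehler.isHarmonicForm_iff_closed_and_coclosed`.
[cite: WarnerGTM94, Prop. 6.3, p. 221] -/
def isHarmonicForm_iff_mextDeriv_eq_zero_and_mcoderiv_eq_zero_of_isManifold : Prop :=
  ∀ {E : Type*} [NormedAddCommGroup E] [NormedSpace ℝ E] {n : ℕ} [Fact (finrank ℝ E = n)]
    {H : Type*} [TopologicalSpace H] {I : ModelWithCorners ℝ E H}
    {M : Type*} [TopologicalSpace M] [ChartedSpace H M] [T2Space M] [IsManifold I ∞ M]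
    [FiniteDimensional ℝ E] [RiemannianBundle (fun x : M ↦ TangentSpace I x)]
    [IsContinuousRiemannianBundle E (fun x : M ↦ TangentSpace I x)]
    [IsContMDiffRiemannianBundle I ∞ E (fun x : M ↦ TangentSpace I x)] {k m : ℕ}
    (o : (x : M) → Orientation ℝ (TangentSpace I x) (Fin n)) [CompactSpace M] [I.Boundaryless],
    IsSmoothForm (riemannianVolumeForm o) → ∀ (h : (k + 1) + m = n) {α : MForm I M ℝ (k + 1)},
      IsSmoothForm α → (IsHarmonicForm o h α ↔ mextDeriv α = 0 ∧ mcoderiv o h α = 0)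

/-- **Discharge** of `isHarmonicForm_iff_mextDeriv_eq_zero_and_mcoderiv_eq_zero_of_isManifold`
(the corrected form of the named fact `isHarmonicForm_iff_mextDeriv_eq_zero_and_mcoderiv_eq_zero`):
immediate from `isHarmonicForm_iff_closed_and_coclosed`. Warner (1983), Prop. 6.3, p. 221.
[cite: WarnerGTM94, Prop. 6.3, p. 221] -/
theorem isHarmonicForm_iff_mextDeriv_eq_zero_and_mcoderiv_eq_zero_of_isManifold_holds :
    isHarmonicForm_iff_mextDeriv_eq_zero_and_mcoderiv_eq_zero_of_isManifold :=
  fun o _ _ ho h _ hα ↦ isHarmonicForm_iff_closed_and_coclosed o ho h hα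

end CorrectedFact

end Literature.Geometry.Kaehler
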